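import Summits.CriticalPhenomena.PercolationContinuityZ3.Theorems.Transplant.GridCoverNets
import Summits.CriticalPhenomena.PercolationContinuityZ3.Theorems.Transplant.PlanarSkeletonFrmScaledDefs
import HarnessLib

/-!
# The QUARTZ net (`qtz`) carries NO planar unit-step skeleton — `PlanarSkeletonFrm`, `…Neg`, `…Sign`, `…Conc`, `…FrmFrom`, `…FrmScaled` are EMPTY
# for EVERY chart (a kernel method-void certificate: three hexagons through one vertex and a pigeonhole in the four step codes)

builds on p205010 (kernel theorem, internal audit signed; external expert review pending) — nothing in this file uses p205010.
Lane `prim-bschramm`, seat `prim-bschramm-p4` (gen 19; PART C3, `HOME/bschramm/P4-GENERAL.md` §41).  Helper file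
(`--supports stmt-CriticalPhenomena-4575 --as helper`).

THE NET.  `qtz` = the Si net of β-quartz, space group P6₂22, sites `3c`, 4-regular, chiral, vertex symbol `6·6·6₂·6₂·8₇·8₇`; every site has two
bonds to the level above and two to the level below (`c/3` apart).  Integer model on `ℤ³` (`TableNet`, 3 classes): in scaled coordinates `(2a, 2b, 3c)` the
classes are `A = (1,0,0)`, `B = (0,1,2)`, `C = (1,1,1)` `mod (2,2,3)`; the site `(n₁, n₂, 3n₃ + c)` stands for `r_c + (2n₁, 2n₂, 3n₃)`; bond table `Qtz.bonds`
(the bonds of `A(1,0,0)` are `C(1,±1,1)`, `B(2,1,−1)`, `B(0,−1,−1)`, the others their `3₂`-screw images).  4-regular (`Qtz.degree_eq`); coordination sequence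
`4, 12, 30, 52, 80, 116, 156, …` = RCSR `qtz` (checked numerically in the seat, `HOME/prim-bschramm-p4-g19/cover/`).
THE CERTIFICATE (found as the minimal core of an exhaustive search; it is a pen-and-paper argument).  Let `φ` carry the field (ι).  At `A = (0,0,0)` let the
darts to the two upper neighbours `C₊ = (0,0,2)`, `C₋ = (0,−1,2)` and the two lower ones `B₊ = (1,0,−2)`, `B₋ = (0,−1,−2)` have codes `u₊, u₋, w₊, w₋` — all
four codes.  Three hexagons pass through `A`: the helical one `A C₊ X T Y C₋` (`X = (1,0,1)`, `T = (0,0,3)`, `Y = (0,−1,1)`: up three levels along one strand,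
down along the other) and the two lateral ones `A C₊ X P Q B₊`, `A C₋ Y P′ Q′ B₋`.  With `a` the code of `C₊ → X`, HEXAGON ANTIPODALITY gives: in the
helical hexagon `X → T` has code `u₋`, `Y → C₋` has code `−a` (so `C₋ → Y` has code `a`) and `Y → T` has code `u₊`; in the lateral ones `X → P` has code
`w₊` and `Y → P′` has code `w₋`.  Labels at `X` are injective: `−a` (towards `C₊`) differs from `u₋, w₊`; at `Y`: `−a` (towards `C₋`) differs from `u₊, w₋`.
So `−a` is none of the four codes — absurd (`GridCover.qtz_codes_false`).  Hence **`Qtz.isEmpty_planarSkeletonFrm / Neg / Sign / Conc / FrmFrom /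
FrmScaled`**: like `nbo`, `lon`, `sod`, the quartz net admits no chart with single-edge steps of any common length, whatever the types and symmetries.
[cite: KozmaNitzan2024, §4 p. 15 (outward steps), p. 16 (Lemma 8)] [cite: ConwaySloane1999, Ch. 4 §6.1]
-/

namespace Summit.CriticalPhenomena.PercolationContinuityZ3.Theorems.Transplant

open Literature.Probability.Percolation Literature.Probability.LatticeModels SimpleGraph GridCover

namespace GridCover

/-- **Pigeonhole in the four step codes**: four pairwise distinct codes exhaust `Fin 4`, so no fifth code avoids them all. [folklore] -/
theorem qtz_codes_false : ∀ a b c d e : Fin 4, a ≠ b → a ≠ c → a ≠ d → b ≠ c → b ≠ d → c ≠ d → e ≠ a → e ≠ b → e ≠ c → e ≠ d → False := by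
  decide

end GridCover

namespace Qtz

/-! ## §1 The quartz graph on `ℤ³` -/

/-- The bond table of `qtz` (classes `0 = A, 1 = B, 2 = C`). [cite: ConwaySloane1999, Ch. 4 §6.1] -/
def bonds : Fin 3 → Finset (Site 3) :=
  ![{![0, -1, -2], ![0, -1, 2], ![0, 0, 2], ![1, 0, -2]},
    {![-1, 0, 1], ![-1, 0, 2], ![0, 0, 1], ![0, 1, 2]},
    {![0, 0, -2], ![0, 0, -1], ![0, 1, -2], ![1, 0, -1]}]

/-- No zero bond. [folklore] -/
theorem zero_notMem_bonds : ∀ c, (0 : Site 3) ∉ bonds c := by decide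

/-- The bond table is symmetric. [folklore] -/
theorem neg_mem_bonds : ∀ c, ∀ v ∈ bonds c, -v ∈ bonds (TableNet.tgt 2 c v) := by decide

/-- Four bonds at every site. [folklore] -/
theorem card_bonds : ∀ c, (bonds c).card = 4 := by decide

/-- **The quartz graph.** [cite: ConwaySloane1999, Ch. 4 §6.1] -/
def graph : SimpleGraph (Site 3) := TableNet.graph 2 bonds

/-- The quartz graph is locally finite. [folklore] -/
noncomputable instance graph_locallyFinite : graph.LocallyFinite := TableNet.graph_locallyFinite

/-- **`qtz` is 4-regular.** [cite: ConwaySloane1999, Ch. 4 §6.1] -/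
theorem degree_eq (x : Site 3) : graph.degree x = 4 := TableNet.degree_eq zero_notMem_bonds neg_mem_bonds card_bonds x

/-- A table bond is an edge. [folklore] -/
theorem adj_of_mem {x y : Site 3} (h : y - x ∈ bonds (TableNet.cls 2 x)) : graph.Adj x y := TableNet.adj_of_mem zero_notMem_bonds h

/-! ## §2 Three hexagons through `A = (0,0,0)` -/

/-- The helical hexagon `A C₊ X T Y C₋` (three levels up along one strand, down along the other). [folklore] -/
noncomputable def hexUp : GridHexagon graph where
  v₀ := ![0, 0, 0]
  v₁ := ![0, 0, 2]
  v₂ := ![1, 0, 1]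
  v₃ := ![0, 0, 3]
  v₄ := ![0, -1, 1]
  v₅ := ![0, -1, 2]
  h₀₁ := adj_of_mem (by decide)
  h₁₂ := adj_of_mem (by decide)
  h₂₃ := adj_of_mem (by decide)
  h₃₄ := adj_of_mem (by decide)
  h₄₅ := adj_of_mem (by decide)
  h₅₀ := adj_of_mem (by decide)
  n₀₂ := by decide
  n₁₃ := by decide
  n₂₄ := by decide
  n₃₅ := by decide
  n₄₀ := by decide
  n₅₁ := by decide
  d₀ := (degree_eq _).le
  d₁ := (degree_eq _).le
  d₂ := (degree_eq _).le
  d₃ := (degree_eq _).le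
  d₄ := (degree_eq _).le
  d₅ := (degree_eq _).le

/-- The lateral hexagon `A C₊ X P Q B₊`. [folklore] -/
noncomputable def hexRight : GridHexagon graph where
  v₀ := ![0, 0, 0]
  v₁ := ![0, 0, 2]
  v₂ := ![1, 0, 1]
  v₃ := ![1, 0, 2]
  v₄ := ![1, 1, 0]
  v₅ := ![1, 0, -2]
  h₀₁ := adj_of_mem (by decide)
  h₁₂ := adj_of_mem (by decide)
  h₂₃ := adj_of_mem (by decide)
  h₃₄ := adj_of_mem (by decide)
  h₄₅ := adj_of_mem (by decide)
  h₅₀ := adj_of_mem (by decide)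
  n₀₂ := by decide
  n₁₃ := by decide
  n₂₄ := by decide
  n₃₅ := by decide
  n₄₀ := by decide
  n₅₁ := by decide
  d₀ := (degree_eq _).le
  d₁ := (degree_eq _).le
  d₂ := (degree_eq _).le
  d₃ := (degree_eq _).le
  d₄ := (degree_eq _).le
  d₅ := (degree_eq _).le

/-- The lateral hexagon `A C₋ Y P′ Q′ B₋`. [folklore] -/
noncomputable def hexLeft : GridHexagon graph where
  v₀ := ![0, 0, 0]
  v₁ := ![0, -1, 2]
  v₂ := ![0, -1, 1]
  v₃ := ![-1, -1, 2]
  v₄ := ![-1, -1, 0]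
  v₅ := ![0, -1, -2]
  h₀₁ := adj_of_mem (by decide)
  h₁₂ := adj_of_mem (by decide)
  h₂₃ := adj_of_mem (by decide)
  h₃₄ := adj_of_mem (by decide)
  h₄₅ := adj_of_mem (by decide)
  h₅₀ := adj_of_mem (by decide)
  n₀₂ := by decide
  n₁₃ := by decide
  n₂₄ := by decide
  n₃₅ := by decide
  n₄₀ := by decide
  n₅₁ := by decide
  d₀ := (degree_eq _).le
  d₁ := (degree_eq _).le
  d₂ := (degree_eq _).le
  d₃ := (degree_eq _).le
  d₄ := (degree_eq _).le
  d₅ := (degree_eq _).le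

/-! ## §3 The certificate -/

/-- **No chart on `qtz` has the outward-step field (ι).** [cite: KozmaNitzan2024, §4 p. 15] -/
theorem false_of_unitSteps {φ : Site 3 → Site 2}
    (hstep : ∀ (v : Site 3) (i : Fin 2) (σ : ℤˣ), ∃ v' : Site 3, graph.Adj v v' ∧ φ v' = φ v + Pi.single i (σ : ℤ)) : False := by
  -- helical hexagon: x0 = u₊ (A→C₊), x1 = a (C₊→X), x2 (X→T); closing darts: φ Y − φ T = vec (opp x0), φ C₋ − φ Y = vec (opp x1), φ A − φ C₋ = vec (opp x2)
  obtain ⟨x0, x1, x2, hx0, hx1, hx2, hx3, hx4, hx5, -⟩ := hexUp.rect hstep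
  -- right hexagon: only the third code y2 (X→P) and the closing dart φ A − φ B₊ = vec (opp y2) are used
  obtain ⟨_y0, _y1, y2, -, -, hy2, -, -, hy5, -⟩ := hexRight.rect hstep
  -- left hexagon: only z2 (Y→P′) and the closing dart φ A − φ B₋ = vec (opp z2) are used
  obtain ⟨_z0, _z1, z2, -, -, hz2, -, -, hz5, -⟩ := hexLeft.rect hstep
  -- darts at A: A→C₊ (x0), A→C₋ (x2, from hx5), A→B₊ (y2, from hy5), A→B₋ (z2, from hz5)
  have hAm : φ hexUp.v₅ - φ hexUp.v₀ = vec x2 := by rw [← opp_opp x2, vec_opp, ← hx5, neg_sub]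
  have hAp : φ hexRight.v₅ - φ hexRight.v₀ = vec y2 := by rw [← opp_opp y2, vec_opp, ← hy5, neg_sub]
  have hAq : φ hexLeft.v₅ - φ hexLeft.v₀ = vec z2 := by rw [← opp_opp z2, vec_opp, ← hz5, neg_sub]
  -- darts at X = (1,0,1): X→C₊ has code opp x1, X→T has code x2, X→P has code y2
  have hXC : φ hexUp.v₁ - φ hexUp.v₂ = vec (opp x1) := by rw [vec_opp, ← hx1, neg_sub]
  have dX := (degree_eq hexUp.v₂).le
  have n1 := code_ne_of_ne hstep dX hexUp.h₁₂.symm hexUp.h₂₃ (by decide) hXC hx2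
  have n2 := code_ne_of_ne hstep dX hexUp.h₁₂.symm hexRight.h₂₃ (by decide) hXC hy2
  -- darts at Y = (0,-1,1): Y→C₋ has code opp x1 (hx4), Y→T has code x0 (reverse of hx3), Y→P′ has code z2
  have hYT : φ hexUp.v₃ - φ hexUp.v₄ = vec x0 := by rw [← opp_opp x0, vec_opp, ← hx3, neg_sub]
  have dY := (degree_eq hexUp.v₄).le
  have n3 := code_ne_of_ne hstep dY hexUp.h₄₅ hexUp.h₃₄.symm (by decide) hx4 hYT
  have n4 := code_ne_of_ne hstep dY hexUp.h₄₅ hexLeft.h₂₃ (by decide) hx4 hz2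
  -- darts at A pairwise distinct
  have dA := (degree_eq hexUp.v₀).le
  have a1 := code_ne_of_ne hstep dA hexUp.h₀₁ hexUp.h₅₀.symm (by decide) hx0 hAm
  have a2 := code_ne_of_ne hstep dA hexUp.h₀₁ hexRight.h₅₀.symm (by decide) hx0 hAp
  have a3 := code_ne_of_ne hstep dA hexUp.h₀₁ hexLeft.h₅₀.symm (by decide) hx0 hAq
  have a4 := code_ne_of_ne hstep dA hexUp.h₅₀.symm hexRight.h₅₀.symm (by decide) hAm hAp
  have a5 := code_ne_of_ne hstep dA hexUp.h₅₀.symm hexLeft.h₅₀.symm (by decide) hAm hAq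
  have a6 := code_ne_of_ne hstep dA hexRight.h₅₀.symm hexLeft.h₅₀.symm (by decide) hAp hAq
  exact qtz_codes_false x0 x2 y2 z2 (opp x1) a1 a2 a3 a4 a5 a6 n3 n1 n2 n4

/-- **THEOREM (kernel no-go): `qtz` carries no `PlanarSkeletonFrm`.** [cite: KozmaNitzan2024, §4 p. 15] -/
theorem isEmpty_planarSkeletonFrm : IsEmpty (PlanarSkeletonFrm graph) := ⟨fun Φ => false_of_unitSteps Φ.step⟩

/-- **… no `PlanarSkeletonNeg`.** [cite: KozmaNitzan2024, §4 p. 16 (Lemma 8)] -/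
theorem isEmpty_planarSkeletonNeg : IsEmpty (PlanarSkeletonNeg graph) := ⟨fun Φ => false_of_unitSteps Φ.step⟩

/-- **… no `PlanarSkeletonSign`.** [cite: KozmaNitzan2024, §4 p. 16 (Lemma 8)] -/
theorem isEmpty_planarSkeletonSign : IsEmpty (PlanarSkeletonSign graph) := ⟨fun Φ => false_of_unitSteps Φ.step⟩

/-- **… no `PlanarSkeletonConc`.** [cite: KozmaNitzan2024, §4 p. 16 (Lemma 8)] -/
theorem isEmpty_planarSkeletonConc : IsEmpty (PlanarSkeletonConc graph) := ⟨fun Φ => false_of_unitSteps Φ.step⟩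

/-- **… no `PlanarSkeletonFrmFrom`.** [cite: KozmaNitzan2024, §4 p. 15] -/
theorem isEmpty_planarSkeletonFrmFrom : IsEmpty (PlanarSkeletonFrmFrom graph) := ⟨fun Φ => false_of_unitSteps Φ.step⟩

/-- **… and no `PlanarSkeletonFrmScaled`** (any step length: the coarse chart of a scaled skeleton has unit steps). [cite: KozmaNitzan2024, §4 p. 15] -/
theorem isEmpty_planarSkeletonFrmScaled : IsEmpty (PlanarSkeletonFrmScaled graph) := ⟨fun Φ => false_of_unitSteps Φ.steps_coarse⟩

end Qtz

end Summit.CriticalPhenomena.PercolationContinuityZ3.Theorems.Transplant
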